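import Summits.Ventures.HodgeRepro2.T5SU11SphericalXiLog

/-!
# The sharp asymptotic of Harish-Chandra's `Ξ` on `SU(1,1)`: `e^{t} Ξ(a_t) / t → 4/π`

`T5SU11SphericalXiLog` squeezed `e^{t} Ξ(a_t)` between `(2/π) log ((π/2) e^{2t} + 1)` and `4 log (e^{2t} + 1)`;
the lower bound already gives `e^{t} Ξ(a_t) ≥ (4/π) t` for `t > 0` (`div_le_exp_mul_sph_one_hyp`). For
the matching upper bound the rescaled Laplace integral
`e^{t} Ξ(a_t) = (2π)⁻¹ ∫_{-π}^{π} (sin²(φ/2) + ε² cos²(φ/2))^{-1/2} dφ`, `ε = e^{-2t}`, is split at `±δ`: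
on `|φ| ≤ δ ≤ 2` the base is `≥ c_δ ((φ/2)² + ε²)` with `c_δ = (1 − δ²/8)²` (`sin x > x − x³/6`,
`cos x ≥ 1 − x²/2`; `rescaled_base_ge_of_abs_le`), and `∫_{-δ}^{δ} ((φ/2)² + ε²)^{-1/2} dφ = 4 arsinh (δ/(2ε))`
(`integral_inv_sqrt_sq_add`, the antiderivative `2 arsinh (φ/(2ε))`) `≤ 4 (2t + log (δ + 1))`
(`arsinh_le_log`); on `δ ≤ |φ| ≤ π` the integrand is `≤ 1/sin (δ/2)`. Hence
**`e^{t} Ξ(a_t) ≤ A_δ + (4/π) (1 − δ²/8)⁻¹ t`** for `t ≥ 0` (`exp_mul_sph_one_hyp_le_linear`), and since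
`δ` is arbitrary, **`e^{t} Ξ(a_t) / t → 4/π`** (`tendsto_exp_mul_sph_one_hyp_div`): the sharp form
`Ξ(a_t) ~ (4/π) t e^{-t}` of Harish-Chandra's logarithmic estimate in the explicit model, with
`(4/π) t e^{-t} ≤ Ξ(a_t)` exactly for `t ≥ 0` (`div_mul_exp_le_sph_one_hyp`). Nothing is claimed about
(N).

Blind lane: Mathlib + the HodgeRepro2 prefix only; no sorry; axioms ⊆ {propext, Classical.choice,
Quot.sound}.
-/

namespace Summit.Ventures.HodgeRepro2.T5SU11SphericalXiAsymptotic

open MeasureTheory Metric Set Filter Topology Complex intervalIntegral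
open T5SU11Unimodular T5SU11Fibration T5SU11Cartan T5SU11OneParameter T5SU11CartanProjection
  T5HaarCircle T5BergmanCoefficient T5SU11SphericalFunction T5SU11SphericalTwo
  T5SU11SphericalSymmetry T5SU11SphericalBounds T5SU11SphericalContinuous
  T5SU11SphericalAsymptotic T5SU11SphericalLp T5SU11SphericalCfun T5SU11SphericalLpSharp
  T5SU11SphericalXiLog
open scoped Real

/-! ### The `arsinh` integral -/

/-- `√(1 + (φ/(2ε))²) = √((φ/2)² + ε²) / ε` for `ε > 0`. -/
lemma sqrt_one_add_div_sq {ε : ℝ} (hε : 0 < ε) (φ : ℝ) :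
    √(1 + (φ / (2 * ε)) ^ 2) = √((φ / 2) ^ 2 + ε ^ 2) / ε := by
  have hS : 0 < √((φ / 2) ^ 2 + ε ^ 2) := Real.sqrt_pos.mpr (by positivity)
  rw [Real.sqrt_eq_iff_mul_self_eq_of_pos (div_pos hS hε), div_mul_div_comm,
    Real.mul_self_sqrt (by positivity), div_eq_iff (by positivity)]
  have hinv : ε * ε⁻¹ = 1 := mul_inv_cancel₀ hε.ne'
  linear_combination (-(φ ^ 2 / 4) * (1 + ε * ε⁻¹)) * hinv

/-- `∂_φ [2 arsinh (φ/(2ε))] = (√((φ/2)² + ε²))⁻¹`. -/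
lemma hasDerivAt_two_arsinh {ε : ℝ} (hε : 0 < ε) (φ : ℝ) :
    HasDerivAt (fun φ => 2 * Real.arsinh (φ / (2 * ε))) (√((φ / 2) ^ 2 + ε ^ 2))⁻¹ φ := by
  have hinner : HasDerivAt (fun φ : ℝ => φ / (2 * ε)) (1 / (2 * ε)) φ := by
    simpa using (hasDerivAt_id' (x := φ)).div_const (2 * ε)
  have h := ((Real.hasDerivAt_arsinh (φ / (2 * ε))).comp φ hinner).const_mul 2
  refine h.congr_deriv ?_
  rw [sqrt_one_add_div_sq hε, inv_div]
  have hS : 0 < √((φ / 2) ^ 2 + ε ^ 2) := Real.sqrt_pos.mpr (by positivity)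
  field_simp

/-- **The `arsinh` integral**: `∫_{-δ}^{δ} (√((φ/2)² + ε²))⁻¹ dφ = 4 arsinh (δ/(2ε))` for `ε > 0`. -/
lemma integral_inv_sqrt_sq_add {ε : ℝ} (hε : 0 < ε) (δ : ℝ) :
    ∫ φ in (-δ)..δ, (√((φ / 2) ^ 2 + ε ^ 2))⁻¹ = 4 * Real.arsinh (δ / (2 * ε)) := by
  have hcont : Continuous fun φ : ℝ => (√((φ / 2) ^ 2 + ε ^ 2))⁻¹ := by
    refine Continuous.inv₀ (by fun_prop) fun φ => ?_
    exact (Real.sqrt_pos.mpr (by positivity)).ne'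
  rw [integral_eq_sub_of_hasDerivAt (fun φ _ => hasDerivAt_two_arsinh hε φ)
    (hcont.intervalIntegrable _ _), neg_div, Real.arsinh_neg]
  ring

/-- `arsinh x ≤ log (2x + 1)` for `x ≥ 0`. -/
lemma arsinh_le_log {x : ℝ} (hx : 0 ≤ x) : Real.arsinh x ≤ Real.log (2 * x + 1) := by
  unfold Real.arsinh
  refine Real.log_le_log (by positivity) ?_
  have : √(1 + x ^ 2) ≤ 1 + x := by
    rw [Real.sqrt_le_iff]
    exact ⟨by linarith, by nlinarith⟩
  linarith

/-! ### The pointwise bounds on the rescaled base -/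

/-- **Near `0`**: for `0 < δ ≤ 2` and `|φ| ≤ δ`,
`(1 − cos φ)/2 + ε²(1 + cos φ)/2 ≥ (1 − δ²/8)² ((φ/2)² + ε²)`. -/
lemma rescaled_base_ge_of_abs_le {δ : ℝ} (hδ0 : 0 < δ) (hδ2 : δ ≤ 2) {φ : ℝ} (hφ : |φ| ≤ δ)
    (t : ℝ) :
    (1 - δ ^ 2 / 8) ^ 2 * ((φ / 2) ^ 2 + Real.exp (-(2 * t)) ^ 2) ≤
      (1 - Real.cos φ) / 2 + Real.exp (-(4 * t)) * ((1 + Real.cos φ) / 2) := by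
  have h4 : Real.exp (-(4 * t)) = Real.exp (-(2 * t)) ^ 2 := by
    rw [sq, ← Real.exp_add]
    congr 1
    ring
  rw [h4, one_sub_cos_div_two, one_add_cos_div_two]
  have hc0 : 0 ≤ 1 - δ ^ 2 / 8 := by nlinarith
  -- `sin²(φ/2) ≥ (1 − δ²/8)² (φ/2)²`
  have hs : (1 - δ ^ 2 / 8) ^ 2 * (φ / 2) ^ 2 ≤ Real.sin (φ / 2) ^ 2 := by
    have key : ∀ x : ℝ, 0 ≤ x → x ≤ δ / 2 → (1 - δ ^ 2 / 8) * x ≤ Real.sin x := by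
      intro x hx0 hx1
      rcases hx0.lt_or_eq with hx | rfl
      · have h1 := Real.sin_gt_sub_cube hx
        have hx2 : x ^ 2 ≤ δ ^ 2 / 4 := by nlinarith
        nlinarith
      · simp
    have hsq : Real.sin (φ / 2) ^ 2 = Real.sin (|φ| / 2) ^ 2 := by
      rcases le_or_gt 0 φ with h | h
      · rw [abs_of_nonneg h]
      · rw [abs_of_neg h, neg_div, Real.sin_neg, neg_sq]
    have h1 := key (|φ| / 2) (by positivity) (by linarith)
    have h2 : (1 - δ ^ 2 / 8) ^ 2 * (φ / 2) ^ 2 = ((1 - δ ^ 2 / 8) * (|φ| / 2)) ^ 2 := by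
      rw [mul_pow, div_pow, div_pow, sq_abs]
    rw [hsq, h2]
    exact pow_le_pow_left₀ (by positivity) h1 2
  -- `cos²(φ/2) ≥ (1 − δ²/8)²`
  have hc : (1 - δ ^ 2 / 8) ^ 2 ≤ Real.cos (φ / 2) ^ 2 := by
    have h1 : 1 - δ ^ 2 / 8 ≤ Real.cos (φ / 2) := by
      have := Real.one_sub_sq_div_two_le_cos (x := φ / 2)
      have hφ2 : (φ / 2) ^ 2 ≤ δ ^ 2 / 4 := by
        have : φ ^ 2 ≤ δ ^ 2 := by
          rw [← sq_abs φ]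
          exact pow_le_pow_left₀ (abs_nonneg φ) hφ 2
        nlinarith
      linarith
    exact pow_le_pow_left₀ hc0 h1 2
  nlinarith [mul_le_mul_of_nonneg_left hc (sq_nonneg (Real.exp (-(2 * t))))]

/-- **Away from `0`**: for `0 < δ ≤ 2` and `δ ≤ |φ| ≤ π`,
`(1 − cos φ)/2 + ε²(1 + cos φ)/2 ≥ sin²(δ/2)`. -/
lemma rescaled_base_ge_of_le_abs {δ : ℝ} (hδ0 : 0 < δ) {φ : ℝ} (h1 : δ ≤ |φ|)
    (h2 : |φ| ≤ π) (t : ℝ) :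
    Real.sin (δ / 2) ^ 2 ≤ (1 - Real.cos φ) / 2 + Real.exp (-(4 * t)) * ((1 + Real.cos φ) / 2) := by
  rw [one_sub_cos_div_two]
  have hπ := Real.pi_pos
  have hsq : Real.sin (φ / 2) ^ 2 = Real.sin (|φ| / 2) ^ 2 := by
    rcases le_or_gt 0 φ with h | h
    · rw [abs_of_nonneg h]
    · rw [abs_of_neg h, neg_div, Real.sin_neg, neg_sq]
  have hmono : Real.sin (δ / 2) ≤ Real.sin (|φ| / 2) :=
    Real.sin_le_sin_of_le_of_le_pi_div_two (by linarith) (by linarith) (by linarith)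
  have hpos : 0 ≤ Real.sin (δ / 2) := Real.sin_nonneg_of_nonneg_of_le_pi (by linarith) (by linarith)
  have := pow_le_pow_left₀ hpos hmono 2
  rw [hsq]
  have h0 : 0 ≤ Real.exp (-(4 * t)) * ((1 + Real.cos φ) / 2) :=
    mul_nonneg (Real.exp_pos _).le (by linarith [Real.neg_one_le_cos φ])
  linarith

/-! ### The upper bound `e^{t} Ξ(a_t) ≤ A_δ + (4/π)(1 − δ²/8)⁻¹ t` -/

/-- `(y²)^{-1/2} = y⁻¹` and `y^{-1/2} = (√y)⁻¹` (`y > 0`). -/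
lemma rpow_neg_half_eq_inv_sqrt {y : ℝ} (hy : 0 < y) : y ^ (-(1 : ℝ) / 2) = (√y)⁻¹ := by
  rw [neg_div, Real.rpow_neg hy.le, Real.sqrt_eq_rpow]

section measure

variable [MeasurableSpace Circle] [BorelSpace Circle]

/-- **The upper bound with the sharp slope**: for `0 < δ ≤ 2` and `t ≥ 0`,
`e^{t} Ξ(a_t) ≤ (2π)⁻¹ (2(π − δ)/sin(δ/2) + 4 (1 − δ²/8)⁻¹ log (δ + 1)) + (4/π)(1 − δ²/8)⁻¹ t`. -/
theorem exp_mul_sph_one_hyp_le_linear {δ : ℝ} (hδ0 : 0 < δ) (hδ2 : δ ≤ 2) {t : ℝ} (ht : 0 ≤ t) :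
    Real.exp t * sph 1 (hyp t) ≤
      (2 * π)⁻¹ * (2 * (π - δ) / Real.sin (δ / 2) + 4 * (1 - δ ^ 2 / 8)⁻¹ * Real.log (δ + 1)) +
        4 / π * (1 - δ ^ 2 / 8)⁻¹ * t := by
  have hπ := Real.pi_pos
  have hδπ : δ ≤ π := hδ2.trans (by linarith [Real.pi_gt_three])
  have hε0 : 0 < Real.exp (-(2 * t)) := Real.exp_pos _
  have hc : 0 < 1 - δ ^ 2 / 8 := by nlinarith
  have hsδ : 0 < Real.sin (δ / 2) := Real.sin_pos_of_pos_of_lt_pi (by linarith) (by linarith)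
  have h := exp_mul_sph_hyp_eq 1 t
  rw [one_mul] at h
  rw [h]
  -- the integrand
  set F : ℝ → ℝ := fun φ =>
    ((1 - Real.cos φ) / 2 + Real.exp (-(4 * t)) * ((1 + Real.cos φ) / 2)) ^ (-(1 : ℝ) / 2) with hF
  have hFc : Continuous F := by
    rw [hF]
    exact Continuous.rpow_const (by fun_prop) fun φ => Or.inl (rescaled_base_pos t φ).ne'
  have hFnn : ∀ φ, 0 ≤ F φ := fun φ => Real.rpow_nonneg (rescaled_base_pos t φ).le _
  -- split the integral at `±δ`
  have hsplit : ∫ φ in (-π)..π, F φ =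
      (∫ φ in (-π)..(-δ), F φ) + (∫ φ in (-δ)..δ, F φ) + ∫ φ in δ..π, F φ := by
    rw [integral_add_adjacent_intervals (hFc.intervalIntegrable _ _) (hFc.intervalIntegrable _ _),
      integral_add_adjacent_intervals (hFc.intervalIntegrable _ _) (hFc.intervalIntegrable _ _)]
  -- the outer pieces
  have houter : ∀ φ, δ ≤ |φ| → |φ| ≤ π → F φ ≤ (Real.sin (δ / 2))⁻¹ := by
    intro φ h1 h2
    rw [hF]
    calc ((1 - Real.cos φ) / 2 + Real.exp (-(4 * t)) * ((1 + Real.cos φ) / 2)) ^ (-(1 : ℝ) / 2)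
        ≤ (Real.sin (δ / 2) ^ 2) ^ (-(1 : ℝ) / 2) :=
          Real.rpow_le_rpow_of_nonpos (by positivity) (rescaled_base_ge_of_le_abs hδ0 h1 h2 t)
            (by norm_num)
      _ = (Real.sin (δ / 2))⁻¹ := sq_rpow_neg_half hsδ
  have hleft : ∫ φ in (-π)..(-δ), F φ ≤ (π - δ) * (Real.sin (δ / 2))⁻¹ := by
    have hmono : ∫ φ in (-π)..(-δ), F φ ≤ ∫ φ in (-π)..(-δ), (Real.sin (δ / 2))⁻¹ := by
      refine integral_mono_on (by linarith) (hFc.intervalIntegrable _ _) intervalIntegrable_const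
        fun φ hφ => ?_
      have hφ1 : -π ≤ φ := hφ.1
      have hφ2 : φ ≤ -δ := hφ.2
      refine houter φ ?_ ?_
      · rw [abs_of_nonpos (by linarith)]; linarith
      · rw [abs_of_nonpos (by linarith)]; linarith
    rw [intervalIntegral.integral_const, smul_eq_mul] at hmono
    calc ∫ φ in (-π)..(-δ), F φ ≤ (-δ - -π) * (Real.sin (δ / 2))⁻¹ := hmono
      _ = (π - δ) * (Real.sin (δ / 2))⁻¹ := by ring
  have hright : ∫ φ in δ..π, F φ ≤ (π - δ) * (Real.sin (δ / 2))⁻¹ := by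
    have hmono : ∫ φ in δ..π, F φ ≤ ∫ φ in δ..π, (Real.sin (δ / 2))⁻¹ := by
      refine integral_mono_on (by linarith) (hFc.intervalIntegrable _ _) intervalIntegrable_const
        fun φ hφ => ?_
      have hφ1 : δ ≤ φ := hφ.1
      have hφ2 : φ ≤ π := hφ.2
      refine houter φ ?_ ?_
      · rw [abs_of_nonneg (by linarith)]; exact hφ1
      · rw [abs_of_nonneg (by linarith)]; exact hφ2
    rw [intervalIntegral.integral_const, smul_eq_mul] at hmono
    exact hmono
  -- the middle piece
  have hmid : ∫ φ in (-δ)..δ, F φ ≤ (1 - δ ^ 2 / 8)⁻¹ * (4 * Real.arsinh (δ / (2 * Real.exp (-(2 * t))))) := by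
    have hG : Continuous fun φ : ℝ => (√((φ / 2) ^ 2 + Real.exp (-(2 * t)) ^ 2))⁻¹ := by
      refine Continuous.inv₀ (by fun_prop) fun φ => ?_
      exact (Real.sqrt_pos.mpr (by positivity)).ne'
    have hpt : ∀ φ, |φ| ≤ δ → F φ ≤ (1 - δ ^ 2 / 8)⁻¹ * (√((φ / 2) ^ 2 + Real.exp (-(2 * t)) ^ 2))⁻¹ := by
      intro φ hφ
      rw [hF]
      have hy : 0 < (φ / 2) ^ 2 + Real.exp (-(2 * t)) ^ 2 := by positivity
      calc ((1 - Real.cos φ) / 2 + Real.exp (-(4 * t)) * ((1 + Real.cos φ) / 2)) ^ (-(1 : ℝ) / 2)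
          ≤ ((1 - δ ^ 2 / 8) ^ 2 * ((φ / 2) ^ 2 + Real.exp (-(2 * t)) ^ 2)) ^ (-(1 : ℝ) / 2) :=
            Real.rpow_le_rpow_of_nonpos (by positivity) (rescaled_base_ge_of_abs_le hδ0 hδ2 hφ t)
              (by norm_num)
        _ = (1 - δ ^ 2 / 8)⁻¹ * (√((φ / 2) ^ 2 + Real.exp (-(2 * t)) ^ 2))⁻¹ := by
            rw [Real.mul_rpow (by positivity) hy.le, sq_rpow_neg_half hc, rpow_neg_half_eq_inv_sqrt hy]
    have hmono : ∫ φ in (-δ)..δ, F φ ≤ ∫ φ in (-δ)..δ,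
        (1 - δ ^ 2 / 8)⁻¹ * (√((φ / 2) ^ 2 + Real.exp (-(2 * t)) ^ 2))⁻¹ := by
      refine integral_mono_on (by linarith) (hFc.intervalIntegrable _ _)
        ((hG.intervalIntegrable _ _).const_mul _) fun φ hφ => ?_
      have hφ1 : -δ ≤ φ := hφ.1
      have hφ2 : φ ≤ δ := hφ.2
      exact hpt φ (abs_le.mpr ⟨hφ1, hφ2⟩)
    rwa [intervalIntegral.integral_const_mul, integral_inv_sqrt_sq_add hε0] at hmono
  -- `arsinh (δ/(2ε)) ≤ 2t + log (δ + 1)`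
  have harsinh : Real.arsinh (δ / (2 * Real.exp (-(2 * t)))) ≤ 2 * t + Real.log (δ + 1) := by
    have h1 := arsinh_le_log (x := δ / (2 * Real.exp (-(2 * t)))) (by positivity)
    have e : 2 * (δ / (2 * Real.exp (-(2 * t)))) + 1 = δ * Real.exp (2 * t) + 1 := by
      rw [Real.exp_neg]
      field_simp
    rw [e] at h1
    have h2 : δ * Real.exp (2 * t) + 1 ≤ (δ + 1) * Real.exp (2 * t) := by
      have := Real.one_le_exp (by linarith : (0 : ℝ) ≤ 2 * t)
      nlinarith
    calc Real.arsinh (δ / (2 * Real.exp (-(2 * t)))) ≤ Real.log (δ * Real.exp (2 * t) + 1) := h1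
      _ ≤ Real.log ((δ + 1) * Real.exp (2 * t)) := Real.log_le_log (by positivity) h2
      _ = 2 * t + Real.log (δ + 1) := by
          rw [Real.log_mul (by positivity) (Real.exp_pos _).ne', Real.log_exp]
          ring
  -- assemble
  have hci : 0 < (1 - δ ^ 2 / 8)⁻¹ := inv_pos.mpr hc
  have hsum : ∫ φ in (-π)..π, F φ ≤
      2 * (π - δ) * (Real.sin (δ / 2))⁻¹ +
        (1 - δ ^ 2 / 8)⁻¹ * (4 * (2 * t + Real.log (δ + 1))) := by
    rw [hsplit]
    have hm2 : (1 - δ ^ 2 / 8)⁻¹ * (4 * Real.arsinh (δ / (2 * Real.exp (-(2 * t))))) ≤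
        (1 - δ ^ 2 / 8)⁻¹ * (4 * (2 * t + Real.log (δ + 1))) :=
      mul_le_mul_of_nonneg_left (by linarith) hci.le
    have hm := hmid.trans hm2
    linarith
  calc (2 * π)⁻¹ * ∫ φ in (-π)..π, F φ
      ≤ (2 * π)⁻¹ * (2 * (π - δ) * (Real.sin (δ / 2))⁻¹ +
          (1 - δ ^ 2 / 8)⁻¹ * (4 * (2 * t + Real.log (δ + 1)))) :=
        mul_le_mul_of_nonneg_left hsum (by positivity)
    _ = (2 * π)⁻¹ * (2 * (π - δ) / Real.sin (δ / 2) + 4 * (1 - δ ^ 2 / 8)⁻¹ * Real.log (δ + 1)) +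
        4 / π * (1 - δ ^ 2 / 8)⁻¹ * t := by
        rw [div_eq_mul_inv (2 * (π - δ)), show 4 / π = 8 * (2 * π)⁻¹ by
          rw [mul_inv, show (8 : ℝ) * (2⁻¹ * π⁻¹) = 4 * π⁻¹ by ring, div_eq_mul_inv]]
        ring

/-! ### The limit `e^{t} Ξ(a_t) / t → 4/π` -/

/-- **The exact lower bound** `(4/π) t ≤ e^{t} Ξ(a_t)` for `t ≥ 0`. -/
theorem div_le_exp_mul_sph_one_hyp (t : ℝ) : 4 / π * t ≤ Real.exp t * sph 1 (hyp t) := by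
  have hπ := Real.pi_pos
  have h := le_exp_mul_sph_one_hyp t
  have hlog : 2 * t ≤ Real.log (π / 2 * Real.exp (2 * t) + 1) := by
    have h1 : Real.exp (2 * t) ≤ π / 2 * Real.exp (2 * t) + 1 := by
      have := Real.exp_pos (2 * t)
      nlinarith [Real.pi_gt_three]
    calc 2 * t = Real.log (Real.exp (2 * t)) := (Real.log_exp _).symm
      _ ≤ Real.log (π / 2 * Real.exp (2 * t) + 1) := Real.log_le_log (Real.exp_pos _) h1
  calc 4 / π * t = 2 / π * (2 * t) := by ring
    _ ≤ 2 / π * Real.log (π / 2 * Real.exp (2 * t) + 1) :=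
        mul_le_mul_of_nonneg_left hlog (by positivity)
    _ ≤ Real.exp t * sph 1 (hyp t) := h

/-- **`(4/π) t e^{-t} ≤ Ξ(a_t)`** (every `t`). -/
theorem div_mul_exp_le_sph_one_hyp (t : ℝ) :
    4 / π * t * Real.exp (-t) ≤ sph 1 (hyp t) := by
  have hpos : 0 < Real.exp t := Real.exp_pos _
  rw [Real.exp_neg, ← div_eq_mul_inv, div_le_iff₀ hpos, mul_comm (sph 1 (hyp t))]
  exact div_le_exp_mul_sph_one_hyp t

/-- **The sharp asymptotic**: `e^{t} Ξ(a_t) / t → 4/π` as `t → ∞`. -/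
theorem tendsto_exp_mul_sph_one_hyp_div :
    Tendsto (fun t : ℝ => Real.exp t * sph 1 (hyp t) / t) atTop (𝓝 (4 / π)) := by
  have hπ := Real.pi_pos
  rw [tendsto_order]
  constructor
  · -- `a < 4/π`: eventually `a < e^t Ξ / t`, since `e^t Ξ / t ≥ 4/π` for `t > 0`
    intro a ha
    filter_upwards [Filter.eventually_gt_atTop 0] with t ht
    have := div_le_exp_mul_sph_one_hyp t
    calc a < 4 / π := ha
      _ = 4 / π * t / t := by rw [mul_div_assoc, div_self ht.ne', mul_one]
      _ ≤ Real.exp t * sph 1 (hyp t) / t := div_le_div_of_nonneg_right this ht.le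
  · -- `b > 4/π`: choose `δ` with `(4/π)(1 − δ²/8)⁻¹ ≤ 4/π + η/2`, then `t` large
    intro b hb
    set η := b - 4 / π with hη
    have hη0 : 0 < η := by rw [hη]; linarith
    -- `δ := min 1 √(π η / 4)`
    set δ : ℝ := min 1 (√(π * η / 4)) with hδ
    have hδ0 : 0 < δ := lt_min one_pos (Real.sqrt_pos.mpr (by positivity))
    have hδ1 : δ ≤ 1 := min_le_left _ _
    have hδ2 : δ ≤ 2 := hδ1.trans one_le_two
    have hδsq : δ ^ 2 ≤ π * η / 4 := by
      have h1 : δ ≤ √(π * η / 4) := min_le_right _ _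
      calc δ ^ 2 ≤ (√(π * η / 4)) ^ 2 := pow_le_pow_left₀ hδ0.le h1 2
        _ = π * η / 4 := Real.sq_sqrt (by positivity)
    have hc : 0 < 1 - δ ^ 2 / 8 := by nlinarith
    -- `(1 − δ²/8)⁻¹ ≤ 1 + δ²/4`
    have hinv : (1 - δ ^ 2 / 8)⁻¹ ≤ 1 + δ ^ 2 / 4 := by
      rw [inv_le_iff_one_le_mul₀ hc]
      have hδsq1 : δ ^ 2 ≤ 1 := by nlinarith
      nlinarith [mul_nonneg (sq_nonneg δ) (sub_nonneg.mpr hδsq1)]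
    -- the slope is at most `4/π + η/4`
    have hslope : 4 / π * (1 - δ ^ 2 / 8)⁻¹ ≤ 4 / π + η / 4 := by
      calc 4 / π * (1 - δ ^ 2 / 8)⁻¹ ≤ 4 / π * (1 + δ ^ 2 / 4) :=
            mul_le_mul_of_nonneg_left hinv (by positivity)
        _ = 4 / π + δ ^ 2 / π := by ring
        _ ≤ 4 / π + η / 4 := by
            have : δ ^ 2 / π ≤ η / 4 := by
              rw [div_le_iff₀ hπ]
              linarith
            linarith
    set A : ℝ := (2 * π)⁻¹ * (2 * (π - δ) / Real.sin (δ / 2) + 4 * (1 - δ ^ 2 / 8)⁻¹ * Real.log (δ + 1))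
      with hA
    -- eventually `A / t ≤ η / 4`
    have hev : ∀ᶠ t : ℝ in atTop, A / t ≤ η / 4 := by
      filter_upwards [Filter.eventually_ge_atTop (max 1 (4 * A / η))] with t ht
      have ht1 : 1 ≤ t := le_trans (le_max_left _ _) ht
      have ht2 : 4 * A / η ≤ t := le_trans (le_max_right _ _) ht
      rw [div_le_iff₀ (by linarith)]
      rw [div_le_iff₀ hη0] at ht2
      linarith
    filter_upwards [hev, Filter.eventually_gt_atTop 0] with t hAt ht
    have hub := exp_mul_sph_one_hyp_le_linear hδ0 hδ2 ht.le
    rw [← hA] at hub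
    calc Real.exp t * sph 1 (hyp t) / t ≤ (A + 4 / π * (1 - δ ^ 2 / 8)⁻¹ * t) / t :=
          div_le_div_of_nonneg_right hub ht.le
      _ = A / t + 4 / π * (1 - δ ^ 2 / 8)⁻¹ := by
          rw [add_div, mul_div_cancel_right₀ _ ht.ne']
      _ ≤ η / 4 + (4 / π + η / 4) := add_le_add hAt hslope
      _ < b := by rw [hη]; linarith

end measure

end Summit.Ventures.HodgeRepro2.T5SU11SphericalXiAsymptotic
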